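import Literature.Analysis.PDE.TorusQuasilinearAPriori
import Literature.Analysis.PDE.TorusLinearSymmetricHyperbolicSymmetrised
import HarnessLib

/-!
# The Picard scheme for quasilinear symmetric hyperbolic systems on `𝕋³` (and on `𝕋^ι` at a
# generic Sobolev margin): existence of the iterates, uniform bounds of every order on a fixed
# time interval, contraction in `L²`, and uniform convergence of all spatial derivatives
# (topic `Analysis/PDE`)

Analysis/PDE support file (everything proved; two `Prop`-valued structures and one definition
with bodies, no named facts) of the energy method for quasilinear symmetric hyperbolic systems
on `𝕋³` (Dafermos 2005, Thm 5.1.1; Majda 1984, Ch. 2, Thm 2.1), towards the named fact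
`Literature.MathematicalPhysics.KineticTheory.hsEuler_localExistence`. For admissible
coefficients (`IsQLSymmCoeff c₀ Λ₀ A₀ A P Q`) and a smooth datum `U₀` the scheme

  `U⁰ ≡ U₀`,  `A₀(Uᵏ) ∂ₜUᵏ⁺¹ + Σⱼ Aⱼ(Uᵏ) ∂ⱼUᵏ⁺¹ = 0`,  `Uᵏ⁺¹(0) = U₀`  (Dafermos (5.1.10))

is well defined with jointly smooth iterates on all of `ℝ × 𝕋³` (`IsQLSymmCoeff.exists_scheme`,
from the linear theory `exists_torus_linear_symmHyp_solution_of_symmetriser`), and this file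
proves Majda's two estimates for it together with their consequence:

* `IsQLSymmCoeff.scheme_estimates` — there is `T > 0` (depending on the coefficients and on
  `U₀` only) such that for EVERY scheme with datum `U₀`: (i) **boundedness in every high norm**
  `twordEnergy m (Uᵏ(t)) ≤ B_m` on `[0, T]`, uniformly in `k`, for every `m` (level `7` by the
  base estimate `twordEnergy_le` with `T` chosen from it, Majda (2.8)–(2.9); the higher levels
  by `step_invariant` on the SAME interval, Majda Thm 2.2 Cor. 1); (ii) **contraction in the
  low norm** `∫‖Uᵏ⁺¹(t) - Uᵏ(t)‖² ≤ d₀ 4^{-k}` on `[0, T]` (Majda (2.10)–(2.12); Dafermos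
  (5.1.23)–(5.1.24));
* `IsQLSymmCoeff.scheme_uniformly_cauchy` — consequently every spatial word derivative
  `∂^w Uᵏ` is uniformly Cauchy on `[0, T] × 𝕋³` (interpolation `‖∂ᵢg‖₂² ≤ ‖g‖₂ ‖∂ᵢ²g‖₂`
  between (i) and (ii), and `H² ⊂ L^∞`; Majda (2.13)–(2.14), Dafermos (5.1.25));
* `IsQLSymmCoeff.IsScheme.reverse` — time reversal maps schemes for `(A₀, Aⱼ)` to schemes for
  `(A₀, -Aⱼ)`, so that all statements are available on `[-T, T]`.

The passage to the limit and the smoothness of the limit are in the sequel file.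

Generic dimension and Sobolev margin: the scheme structure, the two estimates and the uniform
Cauchy property are proved first on `𝕋^ι` for any finite `ι` under the word-form sup embedding
HYPOTHESIS `hS : Torus.WordSupEmbedding ι σ` (`‖f x‖² ≤ C_s · twordEnergy σ f`): `IsSchemeGen`,
`IsQLSymmCoeff.scheme_estimates_of_wordSup` (base level `2σ + 3`, one below the regularity-step
threshold `2σ + 4` of `step_invariant_of_wordSup`),
`IsQLSymmCoeff.scheme_uniformly_cauchy_of_wordSup`, `IsSchemeGen.reverse`, and the existence of
the scheme on `𝕋ⁿ` for every `n` (`IsQLSymmCoeff.exists_schemeGen`, from the linear theory on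
`𝕋ⁿ`); the `𝕋³` statements above are their `ι = Fin 3`, `σ = 2` instances through
`Torus.wordSupEmbedding_fin3_two` and the conversions `IsScheme.isSchemeGen` /
`IsSchemeGen.isScheme` (Majda 1984, Ch. 2 §2.1: the energy method in any number of space
variables once `H^σ ⊂ L^∞`, `2σ > n`). With `Torus.wordSupEmbedding_fin4_three` the `σ = 3`
instances are the scheme estimates of a four-dimensional energy chain.

## Mathlib / tree search

Tree: `exists_torus_linear_symmHyp_solution_of_symmetriser` (`TorusLinearSymmetricHyperbolicSymmetrised`),
`IsQLSymmCoeff.twordEnergy_le/timeDeriv_sq_le/diff_sq_integral_le/step_invariant` and their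
generic-margin forms `…_of_wordSup` (`TorusQuasilinearAPriori`), `Torus.WordSupEmbedding`,
`Torus.wordSupEmbedding_fin3_two` (`FunctionSpaces/TorusWordSupEmbedding`), `l2On_add_le`,
`abs_integral_inner_le_of_memLp` (`CoordWordTame`), `Torus.partialDeriv_inner`,
`Torus.integral_partialDeriv_eq_zero_holds` (`TorusCalculusProofs`), `TorusWordCalculus`.

## References

* A. Majda, *Compressible Fluid Flow and Systems of Conservation Laws in Several Space
  Variables*, Springer 1984, Ch. 2 §2.1, proof of Thm 2.1 ((2.3)–(2.14)) and Thm 2.2 Cor. 1.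
  [`Majda1984`]
* C. M. Dafermos, *Hyperbolic Conservation Laws in Continuum Physics*, 2nd ed., Springer 2005,
  §5.1, proof of Thm 5.1.1 ((5.1.10)–(5.1.25)). [`Dafermos2005`]
-/

noncomputable section

open MeasureTheory Set Filter Function
open scoped ContDiff InnerProductSpace Topology

namespace Literature.Analysis.PDE

open Literature.Analysis.FunctionSpaces Literature.Analysis.FunctionSpaces.Torus

universe u

variable {W : Type u} [NormedAddCommGroup W] [InnerProductSpace ℝ W]

/-! ## An `L²` size functional on torus fields and the interpolation inequality -/

section L2

variable {ι : Type*} [Fintype ι] [DecidableEq ι]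

/-- The `L²` size `‖f‖₂ = ‖𝟙_{[0,1]ⁿ} lift f‖_{L²(ℝⁿ)}` of a torus field (equal to `(∫_𝕋 ‖f‖²)^{1/2}`
for continuous `f`, `tL2_sq`). [folklore] -/
def tL2 (f : UnitAddTorus ι → W) : ℝ := l2On (closedCube ι) (lift f)

omit [InnerProductSpace ℝ W] [DecidableEq ι] in
/-- `0 ≤ ‖f‖₂`. [folklore] -/
theorem tL2_nonneg (f : UnitAddTorus ι → W) : 0 ≤ tL2 f := l2On_nonneg _ _

omit [InnerProductSpace ℝ W] [DecidableEq ι] in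
/-- `‖f‖₂² = ∫ ‖f‖²` for continuous `f`. [folklore] -/
theorem tL2_sq {f : UnitAddTorus ι → W} (hf : Continuous f) : tL2 f ^ 2 = ∫ x, ‖f x‖ ^ 2 :=
  l2On_closedCube_lift_sq hf

omit [InnerProductSpace ℝ W] [DecidableEq ι] in
/-- `‖f‖₂ = √(∫ ‖f‖²)` for continuous `f`. [folklore] -/
theorem tL2_eq_sqrt {f : UnitAddTorus ι → W} (hf : Continuous f) : tL2 f = √(∫ x, ‖f x‖ ^ 2) := by
  rw [← tL2_sq hf, Real.sqrt_sq (tL2_nonneg f)]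

omit [InnerProductSpace ℝ W] [DecidableEq ι] in
/-- **Triangle inequality** `‖f + g‖₂ ≤ ‖f‖₂ + ‖g‖₂`. [folklore] -/
theorem tL2_add_le {f g : UnitAddTorus ι → W} (hf : Continuous f) (hg : Continuous g) :
    tL2 (fun x => f x + g x) ≤ tL2 f + tL2 g :=
  l2On_add_le isCompact_closedCube (hf.comp continuous_proj) (hg.comp continuous_proj)

omit [InnerProductSpace ℝ W] [DecidableEq ι] in
/-- `‖-f‖₂ = ‖f‖₂`. [folklore] -/
theorem tL2_neg {f : UnitAddTorus ι → W} (hf : Continuous f) : tL2 (fun x => -f x) = tL2 f := by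
  have hf' : Continuous fun x => -f x := hf.neg
  rw [tL2_eq_sqrt hf', tL2_eq_sqrt hf]
  simp only [norm_neg]

omit [InnerProductSpace ℝ W] in
/-- `‖a - b‖² ≤ 2‖a‖² + 2‖b‖²`. [folklore] -/
theorem norm_sub_sq_le_two_mul (a b : W) : ‖a - b‖ ^ 2 ≤ 2 * ‖a‖ ^ 2 + 2 * ‖b‖ ^ 2 := by
  have h1 := norm_sub_le a b
  have h2 := mul_self_le_mul_self (norm_nonneg _) h1
  nlinarith [sq_nonneg (‖a‖ - ‖b‖), h2]

omit [DecidableEq ι] in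
/-- **Cauchy–Schwarz** `|∫_𝕋 ⟪f, g⟫| ≤ ‖f‖₂ ‖g‖₂` for continuous fields. [folklore] -/
theorem abs_integral_inner_le_tL2 {f g : UnitAddTorus ι → W} (hf : Continuous f) (hg : Continuous g) :
    |∫ x, ⟪f x, g x⟫_ℝ| ≤ tL2 f * tL2 g := by
  have hK : IsCompact (closedCube ι) := isCompact_closedCube
  rw [integral_eq_integral_closedCube_lift (fun x => ⟪f x, g x⟫_ℝ), ← integral_indicator hK.measurableSet]
  have heq : (closedCube ι).indicator (lift fun x => ⟪f x, g x⟫_ℝ) =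
      fun y => ⟪(closedCube ι).indicator (lift f) y, (closedCube ι).indicator (lift g) y⟫_ℝ := by
    funext y
    by_cases hy : y ∈ closedCube ι
    · simp only [indicator_of_mem hy]; rfl
    · simp only [indicator_of_notMem hy, inner_zero_left]
  rw [heq]
  exact abs_integral_inner_le_of_memLp (memLp_indicator hK (hf.comp continuous_proj))
    (memLp_indicator hK (hg.comp continuous_proj))

/-- **Interpolation**: `∫ ‖∂ᵢ g‖² ≤ ‖g‖₂ ‖∂ᵢ∂ᵢ g‖₂` for smooth `g` (one integration by parts on
the torus and Cauchy–Schwarz). [cite: Majda1984, Ch. 2 §2.1, proof of Thm 2.1, (2.13)] -/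
theorem integral_norm_sq_partialDeriv_le {g : UnitAddTorus ι → W} (hg : IsSmooth g) (i : ι) :
    ∫ x, ‖partialDeriv i g x‖ ^ 2 ≤ tL2 g * tL2 (partialDeriv i (partialDeriv i g)) := by
  have hg1 : IsContDiff 1 g := hg.isContDiff (by simp)
  have hgi : IsSmooth (partialDeriv i g) := hg.partialDeriv i
  have hgi1 : IsContDiff 1 (partialDeriv i g) := hgi.isContDiff (by simp)
  have hgii : IsSmooth (partialDeriv i (partialDeriv i g)) := hgi.partialDeriv i
  -- `∂ᵢ ⟪g, ∂ᵢg⟫ = ⟪g, ∂ᵢ∂ᵢg⟫ + ⟪∂ᵢg, ∂ᵢg⟫` integrates to zero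
  have hprod : IsSmooth fun y => ⟪g y, partialDeriv i g y⟫_ℝ := ContDiff.inner ℝ hg hgi
  have h0 : ∫ x, partialDeriv i (fun y => ⟪g y, partialDeriv i g y⟫_ℝ) x = 0 :=
    integral_partialDeriv_eq_zero_holds hprod i
  have hpt : ∀ x, partialDeriv i (fun y => ⟪g y, partialDeriv i g y⟫_ℝ) x =
      ⟪g x, partialDeriv i (partialDeriv i g) x⟫_ℝ + ‖partialDeriv i g x‖ ^ 2 := fun x => by
    rw [partialDeriv_inner hg1 hgi1 i x, real_inner_self_eq_norm_sq]
  simp_rw [hpt] at h0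
  have hc1 : Continuous fun x => ⟪g x, partialDeriv i (partialDeriv i g) x⟫_ℝ :=
    hg.continuous.inner hgii.continuous
  have hc2 : Continuous fun x => ‖partialDeriv i g x‖ ^ 2 := hgi.continuous.norm.pow 2
  rw [integral_add hc1.integrable_unitAddTorus hc2.integrable_unitAddTorus] at h0
  have h1 : ∫ x, ‖partialDeriv i g x‖ ^ 2 = -∫ x, ⟪g x, partialDeriv i (partialDeriv i g) x⟫_ℝ := by
    linarith
  rw [h1]
  exact (neg_le_abs _).trans (abs_integral_inner_le_tL2 hg.continuous hgii.continuous)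

/-- Word form of the interpolation inequality: `∫ ‖∂^{i w} g‖² ≤ ‖∂^w g‖₂ ‖∂^{i i w} g‖₂`.
[cite: Majda1984, Ch. 2 §2.1, proof of Thm 2.1, (2.13)] -/
theorem integral_norm_sq_iterPartialDeriv_cons_le {g : UnitAddTorus ι → W} (hg : IsSmooth g)
    (i : ι) (w : List ι) :
    ∫ x, ‖iterPartialDeriv (i :: w) g x‖ ^ 2 ≤
      tL2 (iterPartialDeriv w g) * tL2 (iterPartialDeriv (i :: i :: w) g) :=
  integral_norm_sq_partialDeriv_le (hg.iterPartialDeriv w) i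

end L2

/-! ## The scheme in any number of space variables, at a generic Sobolev margin -/

section SchemeGen

variable [CompleteSpace W] [FiniteDimensional ℝ W]
variable {ι : Type*} [Fintype ι] [DecidableEq ι]
variable {c₀ Λ₀ : ℝ} {a0 : W → (W →L[ℝ] W)} {a : ι → W → (W →L[ℝ] W)} {p q : W → (W →L[ℝ] W)}

/-- **A Picard scheme on `𝕋^ι`** (any finite set of directions `ι`; Dafermos (5.1.10); Majda
(2.3)): jointly smooth fields `Uᵏ` on `ℝ × 𝕋^ι` with `U⁰ ≡ U₀`, `Uᵏ(0) = U₀` and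
`A₀(Uᵏ)∂ₜUᵏ⁺¹ + ΣⱼAⱼ(Uᵏ)∂ⱼUᵏ⁺¹ = 0`. The `𝕋³` structure `IsScheme` below is the case `ι = Fin 3`
(`IsScheme.isSchemeGen`, `IsSchemeGen.isScheme`).
[cite: Dafermos2005, §5.1 (5.1.10); Majda1984, Ch. 2 §2.1 (2.3)] -/
structure IsSchemeGen (a0 : W → (W →L[ℝ] W)) (a : ι → W → (W →L[ℝ] W))
    (U₀ : UnitAddTorus ι → W) (U : ℕ → ℝ → UnitAddTorus ι → W) : Prop where
  smooth : ∀ k, IsSmoothSpaceTimeOn univ (U k)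
  zero : ∀ t, U 0 t = U₀
  init : ∀ k, U k 0 = U₀
  eqn : ∀ k t x, a0 (U k t x) (timeDeriv (U (k + 1)) t x) +
    ∑ j, a j (U k t x) (partialDeriv j (U (k + 1) t) x) = 0

namespace IsSchemeGen

variable {U₀ : UnitAddTorus ι → W} {U : ℕ → ℝ → UnitAddTorus ι → W}

omit [CompleteSpace W] [FiniteDimensional ℝ W] in
/-- Every time slice of every iterate of the scheme (Majda (2.3); Dafermos (5.1.10)) is smooth.
[cite: Majda1984, Ch. 2 §2.1 (2.3); Dafermos2005, §5.1 (5.1.10)] -/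
theorem isSmooth (hs : IsSchemeGen a0 a U₀ U) (k : ℕ) (t : ℝ) : IsSmooth (U k t) :=
  (hs.smooth k).isSmooth_slice (mem_univ t)

omit [CompleteSpace W] [FiniteDimensional ℝ W] in
/-- The datum of a scheme (Majda (2.3); Dafermos (5.1.10)) is smooth (it is the slice `U⁰(0)`).
[cite: Majda1984, Ch. 2 §2.1 (2.3); Dafermos2005, §5.1 (5.1.10)] -/
theorem isSmooth_data (hs : IsSchemeGen a0 a U₀ U) : IsSmooth U₀ := by
  rw [← hs.zero 0]; exact hs.isSmooth 0 0

omit [CompleteSpace W] [FiniteDimensional ℝ W] in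
/-- `∂ₜU⁰ = 0` for the constant-in-time zeroth iterate `U⁰ ≡ U₀` of the scheme (Majda (2.3)).
[cite: Majda1984, Ch. 2 §2.1 (2.3); Dafermos2005, §5.1 (5.1.10)] -/
theorem timeDeriv_zero (hs : IsSchemeGen a0 a U₀ U) (t : ℝ) (x : UnitAddTorus ι) :
    timeDeriv (U 0) t x = 0 := by
  have h : (fun τ => U 0 τ x) = fun _ => U₀ x := funext fun τ => by rw [hs.zero τ]
  simp [Torus.timeDeriv, h]

omit [CompleteSpace W] [FiniteDimensional ℝ W] in
/-- **Time reversal of a scheme** on `𝕋^ι`: `t ↦ -t`, `Aⱼ ↦ -Aⱼ` maps solutions of the scheme equations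
(Majda (2.3); Dafermos (5.1.10)) for `(A₀, Aⱼ)` to solutions for `(A₀, -Aⱼ)` with the same datum.
[cite: Majda1984, Ch. 2 §2.1 (2.3); Dafermos2005, §5.1 (5.1.10)] -/
theorem reverse (hs : IsSchemeGen a0 a U₀ U) :
    IsSchemeGen a0 (fun j v => -a j v) U₀ (fun k t x => U k (-t) x) where
  smooth k := by
    have h1 : ContDiff ℝ ∞ (stLift (U k)) := contDiff_stLift_of_isSmoothSpaceTimeOn_univ (hs.smooth k)
    refine isSmoothSpaceTimeOn_of_contDiff ?_ univ
    show ContDiff ℝ ∞ fun z : ℝ × EuclideanSpace ℝ ι => U k (-z.1) (proj z.2)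
    exact h1.comp (contDiff_neg.prodMap contDiff_id)
  zero t := hs.zero (-t)
  init k := by simp [hs.init k]
  eqn k t x := by
    have hd : timeDeriv (fun s y => U (k + 1) (-s) y) t x = -timeDeriv (U (k + 1)) (-t) x := by
      simp only [Torus.timeDeriv]
      exact deriv_comp_neg (f := fun s => U (k + 1) s x) (x := t)
    rw [hd]
    have h := hs.eqn k (-t) x
    simp only [map_neg, FunLike.coe_neg, Pi.neg_apply, Finset.sum_neg_distrib]
    rw [← neg_add, h, neg_zero]

omit [CompleteSpace W] [FiniteDimensional ℝ W] in
/-- Geometric `L²` contraction (Majda (2.12); Dafermos (5.1.24)) makes a scheme on `𝕋^ι` uniformly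
Cauchy in `L²`: `‖Uᵏ⁺ⁿ(t) - Uᵏ(t)‖₂ ≤ 2√d₀ / 2ᵏ` (Majda (2.13)).
[cite: Majda1984, Ch. 2 §2.1, proof of Thm 2.1, (2.12)–(2.13); Dafermos2005, §5.1 (5.1.24)] -/
theorem tL2_sub_le_of_contraction (hs : IsSchemeGen a0 a U₀ U) {T d₀ : ℝ}
    (hcon : ∀ k, ∀ t ∈ Icc 0 T, ∫ x, ‖U (k + 1) t x - U k t x‖ ^ 2 ≤ d₀ / 4 ^ k)
    (k n : ℕ) {t : ℝ} (ht : t ∈ Icc 0 T) :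
    tL2 (fun x => U (k + n) t x - U k t x) ≤ 2 * √d₀ / 2 ^ k := by
  have hd₀ : 0 ≤ d₀ := by
    have := (integral_nonneg fun _ => sq_nonneg _).trans (hcon 0 t ht)
    simpa using this
  have hstep : ∀ j, tL2 (fun x => U (j + 1) t x - U j t x) ≤ √d₀ / 2 ^ j := by
    intro j
    have hc : Continuous fun x => U (j + 1) t x - U j t x :=
      (hs.isSmooth (j + 1) t).continuous.sub (hs.isSmooth j t).continuous
    rw [tL2_eq_sqrt hc]
    have h4 : (4 : ℝ) ^ j = (2 ^ j) ^ 2 := by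
      rw [← pow_mul, mul_comm, pow_mul]; norm_num
    calc √(∫ x, ‖U (j + 1) t x - U j t x‖ ^ 2) ≤ √(d₀ / 4 ^ j) := Real.sqrt_le_sqrt (hcon j t ht)
      _ = √d₀ / 2 ^ j := by
          rw [Real.sqrt_div' _ (by positivity), h4, Real.sqrt_sq (by positivity)]
  -- telescoping
  have htel : ∀ n, tL2 (fun x => U (k + n) t x - U k t x) ≤ √d₀ / 2 ^ k * (2 - 2 / 2 ^ n) := by
    intro n
    induction n with
    | zero =>
      simp only [add_zero, sub_self, pow_zero, div_one]
      have : tL2 (fun _ : UnitAddTorus ι => (0 : W)) = 0 := by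
        rw [tL2_eq_sqrt continuous_const]; simp
      rw [this]; norm_num
    | succ n ih =>
      have hcont1 : Continuous fun x => U (k + n + 1) t x - U (k + n) t x :=
        (hs.isSmooth (k + n + 1) t).continuous.sub (hs.isSmooth (k + n) t).continuous
      have hcont2 : Continuous fun x => U (k + n) t x - U k t x :=
        (hs.isSmooth (k + n) t).continuous.sub (hs.isSmooth k t).continuous
      have heq : (fun x => U (k + (n + 1)) t x - U k t x) =
          fun x => (U (k + n + 1) t x - U (k + n) t x) + (U (k + n) t x - U k t x) := by
        funext x; rw [← add_assoc]; abel
      rw [heq]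
      refine (tL2_add_le hcont1 hcont2).trans ?_
      have h1 := hstep (k + n)
      rw [pow_add] at h1
      have h2n : (0 : ℝ) < 2 ^ n := by positivity
      have h2k : (0 : ℝ) < 2 ^ k := by positivity
      calc tL2 (fun x => U (k + n + 1) t x - U (k + n) t x) + tL2 (fun x => U (k + n) t x - U k t x)
          ≤ √d₀ / (2 ^ k * 2 ^ n) + √d₀ / 2 ^ k * (2 - 2 / 2 ^ n) := add_le_add h1 ih
        _ = √d₀ / 2 ^ k * (2 - 2 / 2 ^ (n + 1)) := by rw [pow_succ]; field_simp; ring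
  refine (htel n).trans ?_
  rw [mul_comm, ← mul_div_assoc]
  refine div_le_div_of_nonneg_right (mul_le_mul_of_nonneg_right (by
    have : 0 ≤ 2 / (2 : ℝ) ^ n := by positivity
    linarith) (Real.sqrt_nonneg _)) (by positivity)

end IsSchemeGen

namespace IsQLSymmCoeff

variable {U₀ : UnitAddTorus ι → W}

/-! ### Uniform bounds and contraction (generic margin) -/

omit [CompleteSpace W] in
/-- **Majda's estimates for the scheme on `𝕋^ι` at a generic Sobolev margin `σ`** (Thm 2.1,
proof, (2.8)–(2.12), and Thm 2.2 Cor. 1, in any number of space variables once `H^σ ⊂ L^∞`):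
under a word-form sup embedding `hS : WordSupEmbedding ι σ` there is `T > 0`, depending only on
the coefficients and the datum, such that every scheme with datum `U₀` is bounded in every
`twordEnergy m` on `[0, T]`, uniformly in `k` (base level `2σ + 3` by `twordEnergy_le_of_wordSup`,
higher levels by `step_invariant_of_wordSup` on the same interval), and contracts in `L²`:
`∫‖Uᵏ⁺¹(t) - Uᵏ(t)‖² ≤ d₀ 4^{-k}` on `[0, T]`. The `𝕋³` case `σ = 2` (base level `7`) is
`scheme_estimates`.
[cite: Majda1984, Ch. 2 §2.1, Thm 2.1 (2.8)–(2.12), Thm 2.2 Cor. 1; Dafermos2005, §5.1 (5.1.16), (5.1.24)] -/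
theorem scheme_estimates_of_wordSup {σ : ℕ} (hS : WordSupEmbedding.{u, _} ι σ)
    (h : IsQLSymmCoeff c₀ Λ₀ a0 a p q) :
    ∃ T : ℝ, 0 < T ∧
      (∀ m : ℕ, ∃ Bm : ℝ, ∀ U, IsSchemeGen a0 a U₀ U → ∀ k, ∀ t ∈ Icc 0 T, twordEnergy m (U k t) ≤ Bm) ∧
      ∃ d₀ : ℝ, ∀ U, IsSchemeGen a0 a U₀ U → ∀ k, ∀ t ∈ Icc 0 T,
        ∫ x, ‖U (k + 1) t x - U k t x‖ ^ 2 ≤ d₀ / 4 ^ k := by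
  have hc₀ := h.pos
  have hΛ₀ := h.Λ₀_nonneg
  -- base level `2σ + 3` (one below the regularity-step threshold `2σ + 4`)
  obtain ⟨Eb, hEb⟩ : ∃ Eb : ℝ, Eb = twordEnergy (2 * σ + 3) U₀ := ⟨_, rfl⟩
  have hEb0 : 0 ≤ Eb := by rw [hEb]; exact twordEnergy_nonneg (2 * σ + 3) U₀
  obtain ⟨R₀, hR₀⟩ : ∃ R₀ : ℝ, R₀ = 2 * (Λ₀ / c₀) * Eb + Eb + 1 := ⟨_, rfl⟩
  have hΛc : 0 ≤ Λ₀ / c₀ := div_nonneg hΛ₀ hc₀.le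
  have hR₀0 : 0 < R₀ := by rw [hR₀]; nlinarith [mul_nonneg hΛc hEb0]
  have hEbR : Eb ≤ R₀ := by rw [hR₀]; nlinarith [mul_nonneg hΛc hEb0]
  obtain ⟨Ct, hCt0, hCt⟩ := h.timeDeriv_sq_le_of_wordSup hS (m := 2 * σ + 3) (by omega) R₀
  obtain ⟨D₀, hD₀⟩ : ∃ D₀ : ℝ, D₀ = √(Ct * R₀) := ⟨_, rfl⟩
  have hD₀0 : 0 ≤ D₀ := by rw [hD₀]; exact Real.sqrt_nonneg _
  obtain ⟨C, hC0, hC⟩ := h.twordEnergy_le_of_wordSup hS (m := 2 * σ + 3) (by omega) R₀ D₀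
  have hlog2 : 0 < Real.log 2 := Real.log_pos (by norm_num)
  have hC1 : 0 < C + 1 := by linarith
  obtain ⟨T₁, hT₁⟩ : ∃ T₁ : ℝ, T₁ = Real.log 2 / (C + 1) := ⟨_, rfl⟩
  have hT₁0 : 0 < T₁ := by rw [hT₁]; exact div_pos hlog2 hC1
  have hexpT : ∀ t ∈ Icc 0 T₁, Real.exp (C * t) ≤ 2 := by
    intro t ht
    have h1 : C * t ≤ Real.log 2 := by
      calc C * t ≤ (C + 1) * T₁ := by nlinarith [ht.1, ht.2]
        _ = Real.log 2 := by rw [hT₁, mul_comm, div_mul_cancel₀ _ hC1.ne']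
    calc Real.exp (C * t) ≤ Real.exp (Real.log 2) := Real.exp_le_exp.2 h1
      _ = 2 := Real.exp_log (by norm_num)
  -- base claim
  have base : ∀ U, IsSchemeGen a0 a U₀ U → ∀ k, ∀ t ∈ Icc 0 T₁,
      twordEnergy (2 * σ + 3) (U k t) ≤ R₀ ∧ ∀ x, ‖timeDeriv (U k) t x‖ ≤ D₀ := by
    intro U hs k
    induction k with
    | zero =>
      intro t ht
      refine ⟨?_, fun x => ?_⟩
      · rw [hs.zero t, ← hEb]
        exact hEbR
      · rw [hs.timeDeriv_zero t x, norm_zero]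
        exact hD₀0
    | succ k ih =>
      intro t ht
      have hVE : ∀ s ∈ Icc 0 T₁, twordEnergy (2 * σ + 3) (U k s) ≤ R₀ := fun s hs' => (ih s hs').1
      have hVd : ∀ s ∈ Icc 0 T₁, ∀ x, ‖timeDeriv (U k) s x‖ ≤ D₀ := fun s hs' => (ih s hs').2
      have hE := hC (U k) (U (k + 1)) T₁ hT₁0 (hs.smooth k) (hs.smooth (k + 1)) hVE hVd (hs.eqn k) t ht
      rw [hs.init (k + 1), ← hEb] at hE
      have hEk : twordEnergy (2 * σ + 3) (U (k + 1) t) ≤ R₀ := by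
        refine hE.trans ?_
        have := hexpT t ht
        have h2 : Λ₀ / c₀ * Real.exp (C * t) * Eb ≤ Λ₀ / c₀ * 2 * Eb :=
          mul_le_mul_of_nonneg_right (mul_le_mul_of_nonneg_left this hΛc) hEb0
        rw [hR₀]
        nlinarith [h2, mul_nonneg hΛc hEb0]
      refine ⟨hEk, fun x => ?_⟩
      have h1 := hCt (U k) (U (k + 1)) (hs.smooth k) (hs.smooth (k + 1)) (hs.eqn k) t (hVE t ht) x
      rw [hD₀, ← Real.sqrt_sq (norm_nonneg _)]
      exact Real.sqrt_le_sqrt (h1.trans (mul_le_mul_of_nonneg_left hEk hCt0))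
  -- higher levels on the same interval
  have higher : ∀ m : ℕ, 2 * σ + 3 ≤ m → ∃ Bm : ℝ, ∀ U, IsSchemeGen a0 a U₀ U → ∀ k, ∀ t ∈ Icc 0 T₁,
      twordEnergy m (U k t) ≤ Bm := by
    intro m hm
    induction m, hm using Nat.le_induction with
    | base => exact ⟨R₀, fun U hs k t ht => (base U hs k t ht).1⟩
    | succ m hm ih =>
      obtain ⟨Bm, hBm⟩ := ih
      obtain ⟨lam, B, hlam, hEiB, hB0, hstep⟩ := h.step_invariant_of_wordSup hS (m := m + 1)
        (by omega) Bm D₀ (twordEnergy (m + 1) U₀)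
      refine ⟨B * Real.exp (lam * T₁), fun U hs k => ?_⟩
      have hinv : ∀ k, ∀ t ∈ Icc 0 T₁, twordEnergy (m + 1) (U k t) ≤ B * Real.exp (lam * t) := by
        intro k
        induction k with
        | zero =>
          intro t ht
          rw [hs.zero t]
          have : 1 ≤ Real.exp (lam * t) := Real.one_le_exp (mul_nonneg hlam ht.1)
          have h2 : B * 1 ≤ B * Real.exp (lam * t) := mul_le_mul_of_nonneg_left this hB0
          linarith [hEiB]
        | succ k ihk =>
          have hm1 : m + 1 - 1 = m := by omega
          refine hstep (U k) (U (k + 1)) T₁ hT₁0 (hs.smooth k) (hs.smooth (k + 1)) ?_ ?_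
            (fun s hs' => (base U hs k s hs').2) (hs.eqn k) (by rw [hs.init]) ihk
          · intro s hs'; rw [hm1]; exact hBm U hs k s hs'
          · intro s hs'; rw [hm1]; exact hBm U hs (k + 1) s hs'
      intro t ht
      refine (hinv k t ht).trans (mul_le_mul_of_nonneg_left (Real.exp_le_exp.2 ?_) hB0)
      exact mul_le_mul_of_nonneg_left ht.2 hlam
  -- contraction
  obtain ⟨Cc, hCc0, hCc⟩ := h.diff_sq_integral_le_of_wordSup hS (m := 2 * σ + 3) (by omega) R₀ D₀
  have hCc1 : 0 < Cc + 1 := by linarith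
  obtain ⟨δc, hδc⟩ : ∃ δc : ℝ, δc = 1 / (4 * (Cc + 1)) := ⟨_, rfl⟩
  have hδc0 : 0 < δc := by rw [hδc]; exact div_pos one_pos (by linarith)
  have hlog : 0 < Real.log (1 + δc) := Real.log_pos (by linarith)
  obtain ⟨T₂, hT₂⟩ : ∃ T₂ : ℝ, T₂ = min T₁ (Real.log (1 + δc) / (Cc + 1)) := ⟨_, rfl⟩
  have hT₂0 : 0 < T₂ := by rw [hT₂]; exact lt_min hT₁0 (div_pos hlog hCc1)
  have hT₂1 : T₂ ≤ T₁ := by rw [hT₂]; exact min_le_left _ _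
  have hT₂2 : T₂ ≤ Real.log (1 + δc) / (Cc + 1) := by rw [hT₂]; exact min_le_right _ _
  have hfac : ∀ t ∈ Icc 0 T₂, Cc * (Real.exp (Cc * t) - 1) ≤ 1 / 4 := by
    intro t ht
    have h1 : Cc * t ≤ Real.log (1 + δc) := by
      calc Cc * t ≤ (Cc + 1) * T₂ := by nlinarith [ht.1, ht.2]
        _ ≤ (Cc + 1) * (Real.log (1 + δc) / (Cc + 1)) := mul_le_mul_of_nonneg_left hT₂2 hCc1.le
        _ = Real.log (1 + δc) := by rw [mul_comm, div_mul_cancel₀ _ hCc1.ne']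
    have h2 : Real.exp (Cc * t) ≤ 1 + δc := by
      calc Real.exp (Cc * t) ≤ Real.exp (Real.log (1 + δc)) := Real.exp_le_exp.2 h1
        _ = 1 + δc := Real.exp_log (by linarith)
    have h3 : Cc * δc ≤ 1 / 4 := by
      rw [hδc, mul_one_div, div_le_iff₀ (by linarith : (0 : ℝ) < 4 * (Cc + 1))]
      linarith
    calc Cc * (Real.exp (Cc * t) - 1) ≤ Cc * δc := mul_le_mul_of_nonneg_left (by linarith) hCc0
      _ ≤ 1 / 4 := h3
  refine ⟨T₂, hT₂0, ?_, ⟨4 * R₀, ?_⟩⟩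
  · intro m
    by_cases hm : 2 * σ + 3 ≤ m
    · obtain ⟨Bm, hBm⟩ := higher m hm
      exact ⟨Bm, fun U hs k t ht => hBm U hs k t ⟨ht.1, ht.2.trans hT₂1⟩⟩
    · refine ⟨R₀, fun U hs k t ht => ?_⟩
      exact (twordEnergy_mono (by omega) _).trans (base U hs k t ⟨ht.1, ht.2.trans hT₂1⟩).1
  · intro U hs k
    induction k with
    | zero =>
      intro t ht
      have ht' : t ∈ Icc 0 T₁ := ⟨ht.1, ht.2.trans hT₂1⟩
      have h1 : ∀ x, ‖U 1 t x - U 0 t x‖ ^ 2 ≤ 2 * ‖U 1 t x‖ ^ 2 + 2 * ‖U 0 t x‖ ^ 2 := fun x =>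
        norm_sub_sq_le_two_mul _ _
      have hc1 : Continuous fun x => ‖U 1 t x‖ ^ 2 := (hs.isSmooth 1 t).continuous.norm.pow 2
      have hc0 : Continuous fun x => ‖U 0 t x‖ ^ 2 := (hs.isSmooth 0 t).continuous.norm.pow 2
      have hcd : Continuous fun x => ‖U 1 t x - U 0 t x‖ ^ 2 :=
        ((hs.isSmooth 1 t).continuous.sub (hs.isSmooth 0 t).continuous).norm.pow 2
      have hi1 : Integrable (fun x => 2 * ‖U 1 t x‖ ^ 2) volume := (continuous_const.mul hc1).integrable_unitAddTorus
      have hi0 : Integrable (fun x => 2 * ‖U 0 t x‖ ^ 2) volume := (continuous_const.mul hc0).integrable_unitAddTorus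
      calc ∫ x, ‖U (0 + 1) t x - U 0 t x‖ ^ 2 ≤ ∫ x, (2 * ‖U 1 t x‖ ^ 2 + 2 * ‖U 0 t x‖ ^ 2) :=
            integral_mono hcd.integrable_unitAddTorus (hi1.add hi0) h1
        _ = 2 * (∫ x, ‖U 1 t x‖ ^ 2) + 2 * ∫ x, ‖U 0 t x‖ ^ 2 := by
            rw [integral_add hi1 hi0, integral_const_mul, integral_const_mul]
        _ ≤ 2 * R₀ + 2 * R₀ := by
            have e1 := (integral_norm_sq_le_twordEnergy (2 * σ + 3) (U 1 t)).trans (base U hs 1 t ht').1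
            have e0 := (integral_norm_sq_le_twordEnergy (2 * σ + 3) (U 0 t)).trans (base U hs 0 t ht').1
            linarith
        _ = 4 * R₀ / 4 ^ 0 := by ring
    | succ k ih =>
      intro t ht
      have hb := fun k s (hs' : s ∈ Icc 0 T₂) => base U hs k s ⟨hs'.1, hs'.2.trans hT₂1⟩
      have hmain := hCc (U (k + 1)) (U k) (U (k + 2)) (U (k + 1)) T₂ (4 * R₀ / 4 ^ k) hT₂0
        (hs.smooth (k + 1)) (hs.smooth k) (hs.smooth (k + 2)) (hs.smooth (k + 1))
        (fun s hs' => (hb (k + 1) s hs').1) (fun s hs' => (hb k s hs').1)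
        (fun s hs' => (hb (k + 1) s hs').1) (fun s hs' => (hb (k + 1) s hs').2)
        (hs.eqn (k + 1)) (hs.eqn k) (by rw [hs.init, hs.init]) ih t ht
      refine hmain.trans ?_
      have hf := hfac t ht
      have hR4 : 0 ≤ 4 * R₀ / 4 ^ k := div_nonneg (by linarith) (pow_nonneg (by norm_num) k)
      calc Cc * (Real.exp (Cc * t) - 1) * (4 * R₀ / 4 ^ k) ≤ 1 / 4 * (4 * R₀ / 4 ^ k) :=
            mul_le_mul_of_nonneg_right hf hR4
        _ = 4 * R₀ / 4 ^ (k + 1) := by rw [pow_succ]; ring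

/-! ### Uniform convergence of all spatial derivatives (generic margin) -/

omit [CompleteSpace W] in
/-- **Uniform convergence of the scheme with all spatial derivatives on `𝕋^ι` at a generic
Sobolev margin `σ`** (Majda (2.13)–(2.14); Dafermos (5.1.25)): with `T` from
`scheme_estimates_of_wordSup`, for every scheme with datum `U₀` and every word `w`, the family
`∂^w Uᵏ` is uniformly Cauchy on `[0, T] × 𝕋^ι` (boundedness of every `twordEnergy`, `L²`
contraction, interpolation and the sup embedding `hS : WordSupEmbedding ι σ`). The `𝕋³` case
`σ = 2` is `scheme_uniformly_cauchy`.
[cite: Majda1984, Ch. 2 §2.1, proof of Thm 2.1, (2.13)–(2.14); Dafermos2005, §5.1 (5.1.25)] -/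
theorem scheme_uniformly_cauchy_of_wordSup {σ : ℕ} (hS : WordSupEmbedding.{u, _} ι σ)
    (h : IsQLSymmCoeff c₀ Λ₀ a0 a p q) :
    ∃ T : ℝ, 0 < T ∧ ∀ U, IsSchemeGen a0 a U₀ U →
      (∀ m : ℕ, ∃ Bm : ℝ, ∀ k, ∀ t ∈ Icc 0 T, twordEnergy m (U k t) ≤ Bm) ∧
      ∀ (w : List ι) (ε : ℝ), 0 < ε → ∃ N : ℕ, ∀ k, N ≤ k → ∀ l, N ≤ l → ∀ t ∈ Icc 0 T, ∀ x,
        ‖iterPartialDeriv w (U k t) x - iterPartialDeriv w (U l t) x‖ ≤ ε := by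
  obtain ⟨T, hT, hbd, d₀, hcon⟩ := h.scheme_estimates_of_wordSup (U₀ := U₀) hS
  obtain ⟨Cs, hCs0, hCs⟩ := hS W
  refine ⟨T, hT, fun U hs => ⟨fun m => ?_, ?_⟩⟩
  · obtain ⟨Bm, hBm⟩ := hbd m
    exact ⟨Bm, hBm U hs⟩
  -- `L²`-Cauchy of every word derivative
  have hdiff : ∀ w k l t, iterPartialDeriv w (fun x => U k t x - U l t x) =
      fun x => iterPartialDeriv w (U k t) x - iterPartialDeriv w (U l t) x := by
    intro w k l t
    have hneg : IsSmooth fun y => (-1 : ℝ) • U l t y := IsSmooth.smul (-1) (hs.isSmooth l t)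
    have h1 := iterPartialDeriv_add (hs.isSmooth k t) hneg w
    have h2 := iterPartialDeriv_const_smul (hs.isSmooth l t) (-1) w
    have e : (fun x => U k t x - U l t x) = fun x => U k t x + (-1 : ℝ) • U l t x := by
      funext x; simp [sub_eq_add_neg]
    rw [e, h1]
    funext x
    have h2x := congr_fun h2 x
    show iterPartialDeriv w (U k t) x + iterPartialDeriv w (fun y => (-1 : ℝ) • U l t y) x = _
    rw [h2x, neg_one_smul, sub_eq_add_neg]
  have hL2 : ∀ w : List ι, ∀ ε, 0 < ε → ∃ N : ℕ, ∀ k, N ≤ k → ∀ l, N ≤ l → ∀ t ∈ Icc 0 T,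
      ∫ x, ‖iterPartialDeriv w (U k t) x - iterPartialDeriv w (U l t) x‖ ^ 2 ≤ ε := by
    intro w
    induction w with
    | nil =>
      intro ε hε
      have hd₀ : 0 ≤ d₀ := by
        have := (integral_nonneg fun _ => sq_nonneg _).trans (hcon U hs 0 0 ⟨le_rfl, hT.le⟩)
        simpa using this
      -- choose `N` with `(4 √d₀ / 2^N)² ≤ ε`
      obtain ⟨N, hN⟩ : ∃ N : ℕ, 4 * √d₀ / 2 ^ N ≤ √ε := by
        have hlim : Tendsto (fun N : ℕ => 4 * √d₀ / 2 ^ N) atTop (𝓝 0) := by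
          have := tendsto_pow_atTop_nhds_zero_of_lt_one (r := (1 / 2 : ℝ)) (by norm_num) (by norm_num)
          have h2 := this.const_mul (4 * √d₀)
          simp only [mul_zero] at h2
          refine h2.congr fun N => ?_
          rw [one_div, inv_pow, div_eq_mul_inv]
        exact ((hlim.eventually (ge_mem_nhds (Real.sqrt_pos.2 hε))).and (eventually_ge_atTop 0)).exists.imp
          fun N hN => hN.1
      refine ⟨N, fun k hk l hl t ht => ?_⟩
      have hck : Continuous fun x => U k t x - U N t x := (hs.isSmooth k t).continuous.sub (hs.isSmooth N t).continuous
      have hcl : Continuous fun x => U N t x - U l t x := (hs.isSmooth N t).continuous.sub (hs.isSmooth l t).continuous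
      have hkl : Continuous fun x => U k t x - U l t x := (hs.isSmooth k t).continuous.sub (hs.isSmooth l t).continuous
      obtain ⟨n₁, rfl⟩ := Nat.exists_eq_add_of_le hk
      obtain ⟨n₂, rfl⟩ := Nat.exists_eq_add_of_le hl
      have h1 := hs.tL2_sub_le_of_contraction (hcon U hs) N n₁ ht
      have h2 := hs.tL2_sub_le_of_contraction (hcon U hs) N n₂ ht
      have h2' : tL2 (fun x => U N t x - U (N + n₂) t x) ≤ 2 * √d₀ / 2 ^ N := by
        have hc' : Continuous fun x => U (N + n₂) t x - U N t x :=
          (hs.isSmooth (N + n₂) t).continuous.sub (hs.isSmooth N t).continuous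
        have e1 : (fun x => U N t x - U (N + n₂) t x) = fun x => -(U (N + n₂) t x - U N t x) := by
          funext x; abel
        rw [e1, tL2_neg hc']
        exact h2
      have heq : (fun x => U (N + n₁) t x - U (N + n₂) t x) =
          fun x => (U (N + n₁) t x - U N t x) + (U N t x - U (N + n₂) t x) := by funext x; abel
      have h3 : tL2 (fun x => U (N + n₁) t x - U (N + n₂) t x) ≤ √ε := by
        rw [heq]
        calc _ ≤ _ := tL2_add_le hck hcl
          _ ≤ 2 * √d₀ / 2 ^ N + 2 * √d₀ / 2 ^ N := add_le_add h1 h2'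
          _ = 4 * √d₀ / 2 ^ N := by ring
          _ ≤ √ε := hN
      show ∫ x, ‖U (N + n₁) t x - U (N + n₂) t x‖ ^ 2 ≤ ε
      rw [← tL2_sq hkl, ← Real.sq_sqrt hε.le]
      exact pow_le_pow_left₀ (tL2_nonneg _) h3 2
    | cons i w ih =>
      intro ε hε
      obtain ⟨B2, hB2⟩ := hbd (w.length + 2)
      -- uniform bound of the second factor
      obtain ⟨M, hM⟩ : ∃ M : ℝ, M = √(4 * |B2|) + 1 := ⟨_, rfl⟩
      have hM0 : 0 < M := by rw [hM]; linarith [Real.sqrt_nonneg (4 * |B2|)]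
      have hεM : 0 < ε / M := div_pos hε hM0
      obtain ⟨N, hN⟩ := ih ((ε / M) ^ 2) (pow_pos hεM 2)
      refine ⟨N, fun k hk l hl t ht => ?_⟩
      have hgs : IsSmooth fun x => U k t x - U l t x := (hs.isSmooth k t).sub (hs.isSmooth l t)
      have h1 := integral_norm_sq_iterPartialDeriv_cons_le hgs i w
      rw [hdiff (i :: w)] at h1
      rw [hdiff w, hdiff (i :: i :: w)] at h1
      -- first factor
      have hf1 : tL2 (fun x => iterPartialDeriv w (U k t) x - iterPartialDeriv w (U l t) x) ≤ ε / M := by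
        have hc : Continuous fun x => iterPartialDeriv w (U k t) x - iterPartialDeriv w (U l t) x :=
          ((hs.isSmooth k t).iterPartialDeriv w).continuous.sub ((hs.isSmooth l t).iterPartialDeriv w).continuous
        rw [tL2_eq_sqrt hc, ← Real.sqrt_sq hεM.le]
        exact Real.sqrt_le_sqrt (hN k hk l hl t ht)
      -- second factor
      have hf2 : tL2 (fun x => iterPartialDeriv (i :: i :: w) (U k t) x -
          iterPartialDeriv (i :: i :: w) (U l t) x) ≤ M := by
        have hc : Continuous fun x => iterPartialDeriv (i :: i :: w) (U k t) x -
            iterPartialDeriv (i :: i :: w) (U l t) x :=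
          ((hs.isSmooth k t).iterPartialDeriv _).continuous.sub ((hs.isSmooth l t).iterPartialDeriv _).continuous
        rw [tL2_eq_sqrt hc]
        have hpt : ∀ x, ‖iterPartialDeriv (i :: i :: w) (U k t) x - iterPartialDeriv (i :: i :: w) (U l t) x‖ ^ 2 ≤
            2 * ‖iterPartialDeriv (i :: i :: w) (U k t) x‖ ^ 2 + 2 * ‖iterPartialDeriv (i :: i :: w) (U l t) x‖ ^ 2 :=
          fun x => norm_sub_sq_le_two_mul _ _
        have hck : Continuous fun x => ‖iterPartialDeriv (i :: i :: w) (U k t) x‖ ^ 2 :=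
          ((hs.isSmooth k t).iterPartialDeriv _).continuous.norm.pow 2
        have hcl : Continuous fun x => ‖iterPartialDeriv (i :: i :: w) (U l t) x‖ ^ 2 :=
          ((hs.isSmooth l t).iterPartialDeriv _).continuous.norm.pow 2
        have hik : Integrable (fun x => 2 * ‖iterPartialDeriv (i :: i :: w) (U k t) x‖ ^ 2) volume :=
          (continuous_const.mul hck).integrable_unitAddTorus
        have hil : Integrable (fun x => 2 * ‖iterPartialDeriv (i :: i :: w) (U l t) x‖ ^ 2) volume :=
          (continuous_const.mul hcl).integrable_unitAddTorus
        have hwlen : (i :: i :: w).length ≤ w.length + 2 := by simp only [List.length_cons]; omega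
        have ek := (integral_norm_sq_iterPartialDeriv_le_twordEnergy hwlen (U k t)).trans (hB2 U hs k t ht)
        have el := (integral_norm_sq_iterPartialDeriv_le_twordEnergy hwlen (U l t)).trans (hB2 U hs l t ht)
        have hI : ∫ x, ‖iterPartialDeriv (i :: i :: w) (U k t) x - iterPartialDeriv (i :: i :: w) (U l t) x‖ ^ 2 ≤
            4 * |B2| := by
          calc _ ≤ ∫ x, (2 * ‖iterPartialDeriv (i :: i :: w) (U k t) x‖ ^ 2 +
                2 * ‖iterPartialDeriv (i :: i :: w) (U l t) x‖ ^ 2) :=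
                integral_mono (hc.norm.pow 2).integrable_unitAddTorus (hik.add hil) hpt
            _ = 2 * (∫ x, ‖iterPartialDeriv (i :: i :: w) (U k t) x‖ ^ 2) +
                2 * ∫ x, ‖iterPartialDeriv (i :: i :: w) (U l t) x‖ ^ 2 := by
                rw [integral_add hik hil, integral_const_mul, integral_const_mul]
            _ ≤ 2 * |B2| + 2 * |B2| := by
                have := le_abs_self B2
                nlinarith
            _ = 4 * |B2| := by ring
        calc √_ ≤ √(4 * |B2|) := Real.sqrt_le_sqrt hI
          _ ≤ M := by rw [hM]; linarith
      calc ∫ x, ‖iterPartialDeriv (i :: w) (U k t) x - iterPartialDeriv (i :: w) (U l t) x‖ ^ 2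
          ≤ _ := h1
        _ ≤ ε / M * M := mul_le_mul hf1 hf2 (tL2_nonneg _) hεM.le
        _ = ε := div_mul_cancel₀ _ hM0.ne'
  -- sup-norm Cauchy via the word-form sup embedding `hS` (`H^σ ⊂ L^∞`)
  intro w ε hε
  obtain ⟨Nw, hNw⟩ : ∃ Nw : ℕ, Nw = (wordsLE ι σ).card := ⟨_, rfl⟩
  have hNw0 : 0 < (Nw : ℝ) := by
    have : ([] : List ι) ∈ wordsLE ι σ := nil_mem_wordsLE σ
    rw [hNw]
    exact_mod_cast Finset.card_pos.2 ⟨[], this⟩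
  -- for each of the finitely many words `v` of length `≤ σ`, an index for the word `v ++ w`
  have hfin : ∀ v ∈ wordsLE ι σ, ∃ N : ℕ, ∀ k, N ≤ k → ∀ l, N ≤ l → ∀ t ∈ Icc 0 T,
      ∫ x, ‖iterPartialDeriv (v ++ w) (U k t) x - iterPartialDeriv (v ++ w) (U l t) x‖ ^ 2 ≤
        ε ^ 2 / (Cs * Nw) := fun v _ => hL2 (v ++ w) _ (div_pos (pow_pos hε 2) (mul_pos hCs0 hNw0))
  choose! Nv hNv using hfin
  refine ⟨(wordsLE ι σ).sup Nv, fun k hk l hl t ht x => ?_⟩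
  have hgs : IsSmooth fun y => iterPartialDeriv w (U k t) y - iterPartialDeriv w (U l t) y := by
    rw [← hdiff w]; exact ((hs.isSmooth k t).sub (hs.isSmooth l t)).iterPartialDeriv w
  have h1 := hCs _ hgs x
  rw [twordEnergy_def] at h1
  have h2 : ∑ v ∈ wordsLE ι σ, ∫ y, ‖iterPartialDeriv v
      (fun y => iterPartialDeriv w (U k t) y - iterPartialDeriv w (U l t) y) y‖ ^ 2 ≤
      ∑ v ∈ wordsLE ι σ, ε ^ 2 / (Cs * Nw) := by
    refine Finset.sum_le_sum fun v hv => ?_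
    have hkv : Nv v ≤ k := (Finset.le_sup hv).trans hk
    have hlv : Nv v ≤ l := (Finset.le_sup hv).trans hl
    have := hNv v hv k hkv l hlv t ht
    rw [← hdiff w, ← iterPartialDeriv_append, hdiff (v ++ w)]
    exact this
  rw [Finset.sum_const, nsmul_eq_mul, ← hNw] at h2
  have h3 : ‖iterPartialDeriv w (U k t) x - iterPartialDeriv w (U l t) x‖ ^ 2 ≤ ε ^ 2 := by
    calc _ ≤ Cs * (Nw * (ε ^ 2 / (Cs * Nw))) := h1.trans (mul_le_mul_of_nonneg_left h2 hCs0.le)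
      _ = ε ^ 2 := by
          rw [← mul_assoc, mul_comm (Cs * Nw), div_mul_cancel₀ _ (mul_pos hCs0 hNw0).ne']
  rw [← Real.sqrt_sq (norm_nonneg _), ← Real.sqrt_sq hε.le]
  exact Real.sqrt_le_sqrt h3

end IsQLSymmCoeff

end SchemeGen

section SchemeGenExists

variable [CompleteSpace W] [FiniteDimensional ℝ W] {n : ℕ}
variable {c₀ Λ₀ : ℝ} {a0 : W → (W →L[ℝ] W)} {a : Fin n → W → (W →L[ℝ] W)} {p q : W → (W →L[ℝ] W)}

namespace IsQLSymmCoeff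

variable {U₀ : UnitAddTorus (Fin n) → W}

/-- **The scheme exists on `𝕋ⁿ`, every `n`** (each step is a linear symmetric hyperbolic system
with the smooth positive symmetriser `P(Uᵏ)`, solved globally in time on `𝕋ⁿ` by the linear
theory `exists_torus_linear_symmHyp_solution_of_symmetriser`). The `𝕋³` case is `exists_scheme`.
[cite: Dafermos2005, §5.1 (5.1.10); Majda1984, Ch. 2 §2.1 (2.3)] -/
theorem exists_schemeGen (h : IsQLSymmCoeff c₀ Λ₀ a0 a p q) (hU₀ : IsSmooth U₀) :
    ∃ U : ℕ → ℝ → UnitAddTorus (Fin n) → W, IsSchemeGen a0 a U₀ U := by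
  have step : ∀ V : {u : ℝ → UnitAddTorus (Fin n) → W // IsSmoothSpaceTimeOn univ u},
      ∃ u : ℝ → UnitAddTorus (Fin n) → W, IsSmoothSpaceTimeOn univ u ∧ u 0 = U₀ ∧
        ∀ t x, a0 (V.1 t x) (timeDeriv u t x) + ∑ j, a j (V.1 t x) (partialDeriv j (u t) x) = 0 := by
    intro V
    have hB : IsSmoothSpaceTimeOn univ (fun (_ : ℝ) (_ : UnitAddTorus (Fin n)) => (0 : W →L[ℝ] W)) :=
      isSmoothSpaceTimeOn_of_contDiff contDiff_const univ
    obtain ⟨u, hu, hu0, hueq⟩ := exists_torus_linear_symmHyp_solution_of_symmetriser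
      (A₀ := fun t x => a0 (V.1 t x)) (A := fun j t x => a j (V.1 t x))
      (B := fun _ _ => (0 : W →L[ℝ] W)) (P := fun t x => p (V.1 t x)) (Q := fun t x => q (V.1 t x))
      (isSmoothSpaceTimeOn_comp h.smooth₀ V.2) (fun j => isSmoothSpaceTimeOn_comp (h.smooth j) V.2)
      hB (isSmoothSpaceTimeOn_comp h.smooth_p V.2) (isSmoothSpaceTimeOn_comp h.smooth_q V.2)
      (fun j t x v w => h.symm j (V.1 t x) v w) (fun t x v w => h.adj (V.1 t x) v w)
      (fun t x v => h.inv (V.1 t x) v) hU₀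
    exact ⟨u, hu, hu0, fun t x => by simpa using hueq t x⟩
  choose F hF using step
  let G : ℕ → {u : ℝ → UnitAddTorus (Fin n) → W // IsSmoothSpaceTimeOn univ u} := fun k =>
    Nat.rec ⟨fun _ => U₀, isSmoothSpaceTimeOn_const hU₀ univ⟩ (fun _ V => ⟨F V, (hF V).1⟩) k
  refine ⟨fun k => (G k).1, fun k => (G k).2, fun t => rfl, fun k => ?_, fun k t x => (hF (G k)).2.2 t x⟩
  cases k with
  | zero => rfl
  | succ k => exact (hF (G k)).2.1

end IsQLSymmCoeff

end SchemeGenExists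

/-! ## The scheme -/

section Scheme

variable [CompleteSpace W] [FiniteDimensional ℝ W]
variable {c₀ Λ₀ : ℝ} {a0 : W → (W →L[ℝ] W)} {a : Fin 3 → W → (W →L[ℝ] W)} {p q : W → (W →L[ℝ] W)}

/-- **A Picard scheme** (Dafermos (5.1.10); Majda (2.3)): jointly smooth fields `Uᵏ` on
`ℝ × 𝕋³` with `U⁰ ≡ U₀`, `Uᵏ(0) = U₀` and `A₀(Uᵏ)∂ₜUᵏ⁺¹ + ΣⱼAⱼ(Uᵏ)∂ⱼUᵏ⁺¹ = 0`.
[cite: Dafermos2005, §5.1 (5.1.10); Majda1984, Ch. 2 §2.1 (2.3)] -/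
structure IsScheme (a0 : W → (W →L[ℝ] W)) (a : Fin 3 → W → (W →L[ℝ] W))
    (U₀ : UnitAddTorus (Fin 3) → W) (U : ℕ → ℝ → UnitAddTorus (Fin 3) → W) : Prop where
  smooth : ∀ k, IsSmoothSpaceTimeOn univ (U k)
  zero : ∀ t, U 0 t = U₀
  init : ∀ k, U k 0 = U₀
  eqn : ∀ k t x, a0 (U k t x) (timeDeriv (U (k + 1)) t x) +
    ∑ j, a j (U k t x) (partialDeriv j (U (k + 1) t) x) = 0

omit [CompleteSpace W] [FiniteDimensional ℝ W] in
/-- A `𝕋³` scheme (Dafermos (5.1.10); Majda (2.3)) is a scheme on `𝕋^ι` for `ι = Fin 3`: the two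
structures have the same fields. [cite: Dafermos2005, §5.1 (5.1.10); Majda1984, Ch. 2 §2.1 (2.3)] -/
theorem IsScheme.isSchemeGen {U₀ : UnitAddTorus (Fin 3) → W} {U : ℕ → ℝ → UnitAddTorus (Fin 3) → W}
    (hs : IsScheme a0 a U₀ U) : IsSchemeGen a0 a U₀ U :=
  ⟨hs.smooth, hs.zero, hs.init, hs.eqn⟩

omit [CompleteSpace W] [FiniteDimensional ℝ W] in
/-- A scheme on `𝕋^ι` for `ι = Fin 3` (Dafermos (5.1.10); Majda (2.3)) is a `𝕋³` scheme: the two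
structures have the same fields. [cite: Dafermos2005, §5.1 (5.1.10); Majda1984, Ch. 2 §2.1 (2.3)] -/
theorem IsSchemeGen.isScheme {U₀ : UnitAddTorus (Fin 3) → W} {U : ℕ → ℝ → UnitAddTorus (Fin 3) → W}
    (hs : IsSchemeGen a0 a U₀ U) : IsScheme a0 a U₀ U :=
  ⟨hs.smooth, hs.zero, hs.init, hs.eqn⟩

namespace IsScheme

variable {U₀ : UnitAddTorus (Fin 3) → W} {U : ℕ → ℝ → UnitAddTorus (Fin 3) → W}

omit [CompleteSpace W] [FiniteDimensional ℝ W] in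
/-- Every slice of every iterate is smooth. [folklore] -/
theorem isSmooth (hs : IsScheme a0 a U₀ U) (k : ℕ) (t : ℝ) : IsSmooth (U k t) :=
  hs.isSchemeGen.isSmooth k t

omit [CompleteSpace W] [FiniteDimensional ℝ W] in
/-- The datum is smooth. [folklore] -/
theorem isSmooth_data (hs : IsScheme a0 a U₀ U) : IsSmooth U₀ :=
  hs.isSchemeGen.isSmooth_data

omit [CompleteSpace W] [FiniteDimensional ℝ W] in
/-- `∂ₜU⁰ = 0`. [folklore] -/
theorem timeDeriv_zero (hs : IsScheme a0 a U₀ U) (t : ℝ) (x : UnitAddTorus (Fin 3)) :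
    timeDeriv (U 0) t x = 0 :=
  hs.isSchemeGen.timeDeriv_zero t x

omit [CompleteSpace W] [FiniteDimensional ℝ W] in
/-- **Time reversal of a scheme.** [folklore] -/
theorem reverse (hs : IsScheme a0 a U₀ U) :
    IsScheme a0 (fun j v => -a j v) U₀ (fun k t x => U k (-t) x) where
  smooth := hs.isSchemeGen.reverse.smooth
  zero := hs.isSchemeGen.reverse.zero
  init := hs.isSchemeGen.reverse.init
  eqn := hs.isSchemeGen.reverse.eqn

end IsScheme

namespace IsQLSymmCoeff

variable {U₀ : UnitAddTorus (Fin 3) → W}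

/-- **The scheme exists** (each step is a linear symmetric hyperbolic system with the smooth
positive symmetriser `P(Uᵏ)`, solved globally in time on the torus).
[cite: Dafermos2005, §5.1 (5.1.10); Majda1984, Ch. 2 §2.1 (2.3)] -/
theorem exists_scheme (h : IsQLSymmCoeff c₀ Λ₀ a0 a p q) (hU₀ : IsSmooth U₀) :
    ∃ U : ℕ → ℝ → UnitAddTorus (Fin 3) → W, IsScheme a0 a U₀ U :=
  (h.exists_schemeGen hU₀).imp fun _ hs => hs.isScheme

/-! ### Uniform bounds and contraction -/

omit [CompleteSpace W] in
/-- **Majda's estimates for the scheme** (Thm 2.1, proof, (2.8)–(2.12), and Thm 2.2 Cor. 1):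
there is `T > 0`, depending only on the coefficients and the datum, such that every scheme with
datum `U₀` is bounded in every `twordEnergy m` on `[0, T]`, uniformly in `k`, and contracts in
`L²`: `∫‖Uᵏ⁺¹(t) - Uᵏ(t)‖² ≤ d₀ 4^{-k}` on `[0, T]`.
[cite: Majda1984, Ch. 2 §2.1, Thm 2.1 (2.8)–(2.12), Thm 2.2 Cor. 1; Dafermos2005, §5.1 (5.1.16), (5.1.24)] -/
theorem scheme_estimates (h : IsQLSymmCoeff c₀ Λ₀ a0 a p q) :
    ∃ T : ℝ, 0 < T ∧
      (∀ m : ℕ, ∃ Bm : ℝ, ∀ U, IsScheme a0 a U₀ U → ∀ k, ∀ t ∈ Icc 0 T, twordEnergy m (U k t) ≤ Bm) ∧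
      ∃ d₀ : ℝ, ∀ U, IsScheme a0 a U₀ U → ∀ k, ∀ t ∈ Icc 0 T,
        ∫ x, ‖U (k + 1) t x - U k t x‖ ^ 2 ≤ d₀ / 4 ^ k := by
  obtain ⟨T, hT, hbd, d₀, hcon⟩ :=
    h.scheme_estimates_of_wordSup (U₀ := U₀) wordSupEmbedding_fin3_two
  exact ⟨T, hT, fun m => (hbd m).imp fun Bm hBm U hs => hBm U hs.isSchemeGen,
    d₀, fun U hs => hcon U hs.isSchemeGen⟩

/-! ### Uniform convergence of all spatial derivatives -/

omit [CompleteSpace W] [FiniteDimensional ℝ W] in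
/-- Geometric `L²` contraction makes the scheme uniformly Cauchy in `L²`. [folklore] -/
theorem tL2_sub_le_of_contraction {U : ℕ → ℝ → UnitAddTorus (Fin 3) → W} {U₀ : UnitAddTorus (Fin 3) → W}
    (hs : IsScheme a0 a U₀ U) {T d₀ : ℝ}
    (hcon : ∀ k, ∀ t ∈ Icc 0 T, ∫ x, ‖U (k + 1) t x - U k t x‖ ^ 2 ≤ d₀ / 4 ^ k)
    (k n : ℕ) {t : ℝ} (ht : t ∈ Icc 0 T) :
    tL2 (fun x => U (k + n) t x - U k t x) ≤ 2 * √d₀ / 2 ^ k :=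
  hs.isSchemeGen.tL2_sub_le_of_contraction hcon k n ht

omit [CompleteSpace W] in
/-- **Uniform convergence of the scheme with all spatial derivatives** (Majda (2.13)–(2.14);
Dafermos (5.1.25)): with `T` from `scheme_estimates`, for every scheme with datum `U₀` and every
word `w`, the family `∂^w Uᵏ` is uniformly Cauchy on `[0, T] × 𝕋³` (boundedness of every
`twordEnergy`, `L²` contraction, interpolation and `H² ⊂ L^∞`).
[cite: Majda1984, Ch. 2 §2.1, proof of Thm 2.1, (2.13)–(2.14); Dafermos2005, §5.1 (5.1.25)] -/
theorem scheme_uniformly_cauchy (h : IsQLSymmCoeff c₀ Λ₀ a0 a p q) :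
    ∃ T : ℝ, 0 < T ∧ ∀ U, IsScheme a0 a U₀ U →
      (∀ m : ℕ, ∃ Bm : ℝ, ∀ k, ∀ t ∈ Icc 0 T, twordEnergy m (U k t) ≤ Bm) ∧
      ∀ (w : List (Fin 3)) (ε : ℝ), 0 < ε → ∃ N : ℕ, ∀ k, N ≤ k → ∀ l, N ≤ l → ∀ t ∈ Icc 0 T, ∀ x,
        ‖iterPartialDeriv w (U k t) x - iterPartialDeriv w (U l t) x‖ ≤ ε := by
  obtain ⟨T, hT, H⟩ :=
    h.scheme_uniformly_cauchy_of_wordSup (U₀ := U₀) wordSupEmbedding_fin3_two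
  exact ⟨T, hT, fun U hs => H U hs.isSchemeGen⟩

end IsQLSymmCoeff

end Scheme

end Literature.Analysis.PDE

end
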